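import Mathlib
import HarnessLib

/-!
# Route `BECTangentRigidity`, crux `RigidMomentumBound` (stmt-AtomisticToContinuum-13034):
# stub `stub_pairCounting` — counting close pairs by cells (pure finite combinatorics)

Fix `N` points `X : Fin N → ℝ³` and radii `0 < r₀ ≤ 2R`.  Write
`A := #{(j,k) : j < k, dist (X j) (X k) < r₀}` (close pairs),
`n i := #{j : dist (X j) (X i) ≤ 2R}`, `M := (8R/r₀ + 2)³`, `n⋆ := maxᵢ n i`, `S := ∑ᵢ n i`.

1. *Cells.*  Index a point `x` of the ball `closedBall c (2R)` by the triple
   `l ↦ ⌊(x l - c l + 2R) / (r₀/2)⌋₊`; the indices lie in the grid `{0,…,⌊8R/r₀⌋₊}³`, which has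
   at most `M` elements, and two points of the ball with the same index are at distance `< r₀`
   (each coordinate differs by `< r₀/2`).  If a finite set of `n` points of the ball has `m_t`
   points of index `t`, Cauchy–Schwarz gives `n² ≤ M ∑ₜ m_t²`, while
   `∑ₜ m_t² = #{ordered pairs in a common cell} ≤ 2·#{close pairs j < k in the set} + n`.
   Applied to the ball around `X i` this is the first conjunct `(n i)² ≤ 2MA + M (n i)`.
2. *Double counting.*  A close pair `(j,k)` lies in the ball around `X i` only if
   `dist (X i) (X j) ≤ 2R`, i.e. for at most `n j ≤ n⋆` centres `i`; summing step 1 over `i`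
   gives `∑ᵢ (n i)² ≤ 2MA·n⋆ + MS`, and Cauchy–Schwarz `S² ≤ N ∑ᵢ (n i)²` gives the second
   conjunct.
-/

noncomputable section

namespace Summit.AtomisticToContinuum.BoseEinsteinCondensation.Theorems.RigidMomentumBound

open scoped BigOperators

namespace PairCounting

section Abstract

variable {α β : Type*} [DecidableEq β]

/-- For a map `f` sending `S` into `T`, the sum over `t ∈ T` of the squared fibre cardinalities
equals the sum over `j ∈ S` of the size of the fibre through `j`. [folklore] -/
theorem sum_card_fiber_sq (S : Finset α) (f : α → β) (T : Finset β) (hT : ∀ j ∈ S, f j ∈ T) :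
    ∑ t ∈ T, (S.filter fun k => f k = t).card ^ 2 =
      ∑ j ∈ S, (S.filter fun k => f k = f j).card := by
  refine Eq.trans (Finset.sum_congr rfl fun t _ => ?_)
    (Finset.sum_fiberwise_of_maps_to' hT fun t => (S.filter fun k => f k = t).card)
  rw [Finset.sum_const, smul_eq_mul, sq]

/-- The sum over `j ∈ S` of the size of the fibre of `f` through `j` is the number of ordered
pairs in `S × S` lying in a common fibre. [folklore] -/
theorem sum_card_fiber_eq_card_filter_prod (S : Finset α) (f : α → β) :
    ∑ j ∈ S, (S.filter fun k => f k = f j).card =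
      ((S ×ˢ S).filter fun p : α × α => f p.2 = f p.1).card := by
  simp only [Finset.card_filter, Finset.sum_product]

/-- Ordered pairs of `S × S` in a common fibre of `f`: if any two points `j < k` of `S` in a
common fibre form a `Q`-pair, there are at most twice the number of `Q`-pairs of `S × S` plus the
diagonal of them. [folklore] -/
theorem card_filter_prod_le [LinearOrder α] (S : Finset α) (f : α → β) (Q : α × α → Prop)
    [DecidablePred Q] (hQ : ∀ j ∈ S, ∀ k ∈ S, j < k → f j = f k → Q (j, k)) :
    ((S ×ˢ S).filter fun p : α × α => f p.2 = f p.1).card ≤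
      2 * ((S ×ˢ S).filter Q).card + S.card := by
  have hsub : ((S ×ˢ S).filter fun p : α × α => f p.2 = f p.1) ⊆
      (S ×ˢ S).filter Q ∪ ((S ×ˢ S).filter Q).image Prod.swap ∪ S.image fun j => (j, j) := by
    rintro ⟨j, k⟩ hp
    simp only [Finset.mem_filter, Finset.mem_product] at hp
    obtain ⟨⟨hj, hk⟩, hfk⟩ := hp
    simp only [Finset.mem_union, Finset.mem_image, Finset.mem_filter, Finset.mem_product]
    rcases lt_trichotomy j k with h | rfl | h
    · exact Or.inl (Or.inl ⟨⟨hj, hk⟩, hQ j hj k hk h hfk.symm⟩)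
    · exact Or.inr ⟨j, hj, rfl⟩
    · exact Or.inl (Or.inr ⟨(k, j), ⟨⟨hk, hj⟩, hQ k hk j hj h hfk⟩, rfl⟩)
  calc ((S ×ˢ S).filter fun p : α × α => f p.2 = f p.1).card
      ≤ ((S ×ˢ S).filter Q ∪ ((S ×ˢ S).filter Q).image Prod.swap ∪
          S.image fun j => (j, j)).card := Finset.card_le_card hsub
    _ ≤ ((S ×ˢ S).filter Q).card + (((S ×ˢ S).filter Q).image Prod.swap).card +
          (S.image fun j => (j, j)).card :=
        (Finset.card_union_le _ _).trans (Nat.add_le_add_right (Finset.card_union_le _ _) _)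
    _ ≤ ((S ×ˢ S).filter Q).card + ((S ×ˢ S).filter Q).card + S.card :=
        add_le_add (Nat.add_le_add_left Finset.card_image_le _) Finset.card_image_le
    _ = 2 * ((S ×ˢ S).filter Q).card + S.card := by ring

/-- **Cell counting.** If `f` maps `S` into `T` and any two points `j < k` of `S` in a common
fibre of `f` form a `Q`-pair, then `#S² ≤ #T · (2 · #{Q-pairs in S × S} + #S)`
(Cauchy–Schwarz over the fibres). [folklore] -/
theorem card_sq_le [LinearOrder α] (S : Finset α) (f : α → β) (T : Finset β)
    (hT : ∀ j ∈ S, f j ∈ T) (Q : α × α → Prop) [DecidablePred Q]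
    (hQ : ∀ j ∈ S, ∀ k ∈ S, j < k → f j = f k → Q (j, k)) :
    S.card ^ 2 ≤ T.card * (2 * ((S ×ˢ S).filter Q).card + S.card) :=
  calc S.card ^ 2 = (∑ t ∈ T, (S.filter fun k => f k = t).card) ^ 2 := by
        rw [Finset.card_eq_sum_card_fiberwise (f := f) (s := S) (t := T) fun j hj => hT j hj]
    _ ≤ T.card * ∑ t ∈ T, (S.filter fun k => f k = t).card ^ 2 := sq_sum_le_card_mul_sum_sq
    _ = T.card * ((S ×ˢ S).filter fun p : α × α => f p.2 = f p.1).card := by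
        rw [sum_card_fiber_sq S f T hT, sum_card_fiber_eq_card_filter_prod]
    _ ≤ T.card * (2 * ((S ×ˢ S).filter Q).card + S.card) :=
        Nat.mul_le_mul_left _ (card_filter_prod_le S f Q hQ)

/-- **Double counting.** For a symmetric neighbourhood system `B` on a finite type, the number of
`Q`-pairs inside `B i × B i`, summed over `i`, is at most the total number of `Q`-pairs times the
largest `#(B i)`: a pair `(j, k)` is counted only for `i ∈ B j`. [folklore] -/
theorem sum_card_pairs_le {ι : Type*} [Fintype ι] [DecidableEq ι] (B : ι → Finset ι)
    (hB : ∀ i j, j ∈ B i → i ∈ B j) (Q : ι × ι → Prop) [DecidablePred Q] :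
    ∑ i, ((B i ×ˢ B i).filter Q).card ≤
      (Finset.univ.filter Q).card * Finset.univ.sup fun i => (B i).card := by
  have e : ∀ i, (B i ×ˢ B i).filter Q =
      (Finset.univ.filter Q).filter fun p : ι × ι => p.1 ∈ B i ∧ p.2 ∈ B i := by
    intro i
    ext p
    simp only [Finset.mem_filter, Finset.mem_product, Finset.mem_univ, true_and]
    tauto
  calc ∑ i, ((B i ×ˢ B i).filter Q).card
      = ∑ i, ((Finset.univ.filter Q).filter fun p : ι × ι => p.1 ∈ B i ∧ p.2 ∈ B i).card :=
        Finset.sum_congr rfl fun i _ => by rw [e i]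
    _ = ∑ i, ∑ p ∈ Finset.univ.filter Q, if p.1 ∈ B i ∧ p.2 ∈ B i then 1 else 0 := by
        simp only [Finset.card_filter]
    _ = ∑ p ∈ Finset.univ.filter Q, ∑ i, if p.1 ∈ B i ∧ p.2 ∈ B i then 1 else 0 :=
        Finset.sum_comm
    _ = ∑ p ∈ Finset.univ.filter Q, (Finset.univ.filter fun i => p.1 ∈ B i ∧ p.2 ∈ B i).card := by
        simp only [Finset.card_filter]
    _ ≤ ∑ p ∈ Finset.univ.filter Q, Finset.univ.sup fun i => (B i).card :=
        Finset.sum_le_sum fun p _ =>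
          calc (Finset.univ.filter fun i => p.1 ∈ B i ∧ p.2 ∈ B i).card ≤ (B p.1).card :=
                Finset.card_le_card fun i hi => hB i p.1 (Finset.mem_filter.1 hi).2.1
            _ ≤ Finset.univ.sup fun i => (B i).card :=
                Finset.le_sup (f := fun i => (B i).card) (Finset.mem_univ p.1)
    _ = (Finset.univ.filter Q).card * Finset.univ.sup fun i => (B i).card := by
        rw [Finset.sum_const, smul_eq_mul]

/-- Arithmetic assembly of the first conjunct: `n² ≤ T (2a + n)`, `a ≤ A`, `T ≤ M` give
`n² ≤ 2MA + Mn`. [folklore] -/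
theorem sq_assembly (n a Tc A : ℕ) (M : ℝ) (hM : (Tc : ℝ) ≤ M)
    (h1 : n ^ 2 ≤ Tc * (2 * a + n)) (h2 : a ≤ A) :
    ((n : ℝ)) ^ 2 ≤ 2 * M * (A : ℝ) + M * (n : ℝ) := by
  have h3 : (n : ℝ) ^ 2 ≤ (Tc : ℝ) * (2 * (A : ℝ) + n) := by
    exact_mod_cast h1.trans (Nat.mul_le_mul_left _ (by omega))
  calc (n : ℝ) ^ 2 ≤ (Tc : ℝ) * (2 * (A : ℝ) + n) := h3
    _ ≤ M * (2 * (A : ℝ) + n) := by gcongr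
    _ = 2 * M * (A : ℝ) + M * (n : ℝ) := by ring

/-- Arithmetic assembly of the second conjunct: `(n i)² ≤ T (2 aᵢ + n i)`, `∑ aᵢ ≤ A n⋆`,
`T ≤ M` and Cauchy–Schwarz `(∑ n i)² ≤ N ∑ (n i)²` give `(∑ n i)² ≤ N (2MA n⋆ + M ∑ n i)`.
[folklore] -/
theorem sum_sq_assembly {N : ℕ} (n a : Fin N → ℕ) (Tc A nstar : ℕ) (M : ℝ) (hM : (Tc : ℝ) ≤ M)
    (h1 : ∀ i, n i ^ 2 ≤ Tc * (2 * a i + n i)) (h2 : ∑ i, a i ≤ A * nstar) :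
    (∑ i, (n i : ℝ)) ^ 2 ≤
      (N : ℝ) * (2 * M * (A : ℝ) * (nstar : ℝ) + M * ∑ i, (n i : ℝ)) := by
  have h3 : (∑ i, n i) ^ 2 ≤ N * ∑ i, n i ^ 2 := by
    simpa using sq_sum_le_card_mul_sum_sq (s := Finset.univ) (f := n)
  have h4 : ∑ i, n i ^ 2 ≤ Tc * (2 * (A * nstar) + ∑ i, n i) :=
    calc ∑ i, n i ^ 2 ≤ ∑ i, Tc * (2 * a i + n i) := Finset.sum_le_sum fun i _ => h1 i
      _ = Tc * (2 * ∑ i, a i + ∑ i, n i) := by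
          rw [← Finset.mul_sum, Finset.sum_add_distrib, ← Finset.mul_sum]
      _ ≤ Tc * (2 * (A * nstar) + ∑ i, n i) := by gcongr
  have h5 : (∑ i, (n i : ℝ)) ^ 2 ≤
      (N : ℝ) * ((Tc : ℝ) * (2 * ((A : ℝ) * (nstar : ℝ)) + ∑ i, (n i : ℝ))) := by
    exact_mod_cast h3.trans (Nat.mul_le_mul_left _ h4)
  calc (∑ i, (n i : ℝ)) ^ 2
      ≤ (N : ℝ) * ((Tc : ℝ) * (2 * ((A : ℝ) * (nstar : ℝ)) + ∑ i, (n i : ℝ))) := h5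
    _ ≤ (N : ℝ) * (M * (2 * ((A : ℝ) * (nstar : ℝ)) + ∑ i, (n i : ℝ))) := by gcongr
    _ = (N : ℝ) * (2 * M * (A : ℝ) * (nstar : ℝ) + M * ∑ i, (n i : ℝ)) := by ring

end Abstract

section Geometry

/-- Two nonnegative reals with the same `⌊· / h⌋₊` differ by less than `h`. [folklore] -/
theorem abs_sub_lt_of_floor_div_eq {u v h : ℝ} (hh : 0 < h) (hu : 0 ≤ u) (hv : 0 ≤ v)
    (e : ⌊u / h⌋₊ = ⌊v / h⌋₊) : |u - v| < h := by
  have h1 := Nat.floor_le (div_nonneg hu hh.le)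
  have h2 := Nat.lt_floor_add_one (u / h)
  have h3 := Nat.floor_le (div_nonneg hv hh.le)
  have h4 := Nat.lt_floor_add_one (v / h)
  have e' : (⌊u / h⌋₊ : ℝ) = ⌊v / h⌋₊ := by exact_mod_cast e
  have k1 : (u - v) / h < 1 := by rw [sub_div]; linarith
  have k2 : (v - u) / h < 1 := by rw [sub_div]; linarith
  rw [div_lt_one hh] at k1 k2
  exact abs_sub_lt_iff.2 ⟨k1, k2⟩

/-- A coordinate of a point of `closedBall c (2R)`, shifted by `2R`, is nonnegative. [folklore] -/
theorem coord_shift_nonneg {x c : EuclideanSpace ℝ (Fin 3)} {R : ℝ} (hx : dist x c ≤ 2 * R)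
    (l : Fin 3) : 0 ≤ x l - c l + 2 * R := by
  have h := (PiLp.dist_apply_le x c l).trans hx
  rw [Real.dist_eq] at h
  linarith [neg_abs_le (x l - c l)]

/-- A coordinate of a point of `closedBall c (2R)`, shifted by `2R`, is at most `4R`.
[folklore] -/
theorem coord_shift_le {x c : EuclideanSpace ℝ (Fin 3)} {R : ℝ} (hx : dist x c ≤ 2 * R)
    (l : Fin 3) : x l - c l + 2 * R ≤ 4 * R := by
  have h := (PiLp.dist_apply_le x c l).trans hx
  rw [Real.dist_eq] at h
  linarith [le_abs_self (x l - c l)]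

/-- The cell index of a point of `closedBall c (2R)` lies in the grid `{0,…,⌊8R/r₀⌋₊}³`.
[folklore] -/
theorem cell_mem {x c : EuclideanSpace ℝ (Fin 3)} {r₀ R : ℝ} (hr₀ : 0 < r₀)
    (hx : dist x c ≤ 2 * R) :
    (fun l : Fin 3 => ⌊(x l - c l + 2 * R) / (r₀ / 2)⌋₊) ∈
      Fintype.piFinset fun _ : Fin 3 => Finset.range (⌊8 * R / r₀⌋₊ + 1) := by
  refine Fintype.mem_piFinset.2 fun l => Finset.mem_range.2 (Nat.lt_succ_of_le ?_)
  refine Nat.floor_le_floor ?_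
  calc (x l - c l + 2 * R) / (r₀ / 2) ≤ 4 * R / (r₀ / 2) := by
        gcongr
        exact coord_shift_le hx l
    _ = 8 * R / r₀ := by
        rw [div_div_eq_mul_div]
        ring

/-- Two points of `closedBall c (2R)` with the same cell index are at distance `< r₀`: each
coordinate differs by `< r₀/2`, so the distance is `< (r₀/2)√3 < r₀`. [folklore] -/
theorem dist_lt_of_cell_eq {x y c : EuclideanSpace ℝ (Fin 3)} {r₀ R : ℝ} (hr₀ : 0 < r₀)
    (hx : dist x c ≤ 2 * R) (hy : dist y c ≤ 2 * R)
    (h : (fun l : Fin 3 => ⌊(x l - c l + 2 * R) / (r₀ / 2)⌋₊) =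
      fun l : Fin 3 => ⌊(y l - c l + 2 * R) / (r₀ / 2)⌋₊) :
    dist x y < r₀ := by
  have hc : ∀ l : Fin 3, dist (x l) (y l) ^ 2 < (r₀ / 2) ^ 2 := fun l => by
    have e : ⌊(x l - c l + 2 * R) / (r₀ / 2)⌋₊ = ⌊(y l - c l + 2 * R) / (r₀ / 2)⌋₊ :=
      congr_fun h l
    have h1 := abs_sub_lt_of_floor_div_eq (half_pos hr₀) (coord_shift_nonneg hx l)
      (coord_shift_nonneg hy l) e
    rw [show x l - c l + 2 * R - (y l - c l + 2 * R) = x l - y l by ring, ← Real.dist_eq] at h1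
    exact pow_lt_pow_left₀ h1 dist_nonneg two_ne_zero
  rw [EuclideanSpace.dist_eq, Real.sqrt_lt' hr₀, Fin.sum_univ_three]
  have h0 := hc 0
  have h1 := hc 1
  have h2 := hc 2
  nlinarith [sq_nonneg r₀]

/-- The grid `{0,…,⌊8R/r₀⌋₊}³` has at most `(8R/r₀ + 2)³` cells. [folklore] -/
theorem card_cells_le {r₀ R : ℝ} (hr₀ : 0 < r₀) (hR : r₀ ≤ 2 * R) :
    ((Fintype.piFinset fun _ : Fin 3 => Finset.range (⌊8 * R / r₀⌋₊ + 1)).card : ℝ) ≤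
      (8 * R / r₀ + 2) ^ 3 := by
  rw [Fintype.card_piFinset_const, Finset.card_range]
  push_cast
  have hR' : 0 ≤ R := by linarith
  have h1 := Nat.floor_le (show 0 ≤ 8 * R / r₀ by positivity)
  gcongr ?_ ^ 3
  linarith

/-- **Cell counting in a ball.** For points `X j`, `j ∈ S`, of `closedBall c (2R)`:
`#S² ≤ #grid · (2 · #{close pairs j < k in S × S} + #S)`. [folklore] -/
theorem card_sq_le_of_dist_le {N : ℕ} (X : Fin N → EuclideanSpace ℝ (Fin 3)) {r₀ R : ℝ}
    (hr₀ : 0 < r₀) (c : EuclideanSpace ℝ (Fin 3)) (S : Finset (Fin N))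
    (hS : ∀ j ∈ S, dist (X j) c ≤ 2 * R) :
    S.card ^ 2 ≤ (Fintype.piFinset fun _ : Fin 3 => Finset.range (⌊8 * R / r₀⌋₊ + 1)).card *
      (2 * ((S ×ˢ S).filter fun p : Fin N × Fin N =>
        p.1 < p.2 ∧ dist (X p.1) (X p.2) < r₀).card + S.card) :=
  card_sq_le S (fun j => fun l : Fin 3 => ⌊(X j l - c l + 2 * R) / (r₀ / 2)⌋₊) _
    (fun j hj => cell_mem hr₀ (hS j hj)) _
    fun j hj k hk hjk hcell => ⟨hjk, dist_lt_of_cell_eq hr₀ (hS j hj) (hS k hk) hcell⟩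

end Geometry

section Conjuncts

variable {N : ℕ} (X : Fin N → EuclideanSpace ℝ (Fin 3)) {r₀ R : ℝ}

/-- First conjunct of `stub_pairCounting`: `(n i)² ≤ 2MA + M (n i)`. [folklore] -/
theorem card_ball_sq_le (hr₀ : 0 < r₀) (hR : r₀ ≤ 2 * R) (i : Fin N) :
    (((Finset.univ.filter fun j : Fin N => dist (X j) (X i) ≤ 2 * R).card : ℝ)) ^ 2 ≤
      2 * (8 * R / r₀ + 2) ^ 3 *
          ((Finset.univ.filter fun p : Fin N × Fin N =>
            p.1 < p.2 ∧ dist (X p.1) (X p.2) < r₀).card : ℝ) +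
        (8 * R / r₀ + 2) ^ 3 *
          ((Finset.univ.filter fun j : Fin N => dist (X j) (X i) ≤ 2 * R).card : ℝ) :=
  sq_assembly _ _ _ _ _ (card_cells_le hr₀ hR)
    (card_sq_le_of_dist_le X hr₀ (X i)
      (Finset.univ.filter fun j : Fin N => dist (X j) (X i) ≤ 2 * R)
      fun _ hj => (Finset.mem_filter.1 hj).2)
    (Finset.card_le_card (Finset.filter_subset_filter _ (Finset.subset_univ _)))

/-- Second conjunct of `stub_pairCounting`: `S² ≤ N (2MA n⋆ + MS)`. [folklore] -/
theorem sum_card_ball_sq_le (hr₀ : 0 < r₀) (hR : r₀ ≤ 2 * R) :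
    (∑ i : Fin N, ((Finset.univ.filter fun j : Fin N => dist (X j) (X i) ≤ 2 * R).card : ℝ)) ^ 2 ≤
      (N : ℝ) * (2 * (8 * R / r₀ + 2) ^ 3 *
          ((Finset.univ.filter fun p : Fin N × Fin N =>
            p.1 < p.2 ∧ dist (X p.1) (X p.2) < r₀).card : ℝ) *
          ((Finset.univ.sup fun i : Fin N =>
            (Finset.univ.filter fun j : Fin N => dist (X j) (X i) ≤ 2 * R).card : ℕ) : ℝ) +
        (8 * R / r₀ + 2) ^ 3 *
          ∑ i : Fin N,
            ((Finset.univ.filter fun j : Fin N => dist (X j) (X i) ≤ 2 * R).card : ℝ)) := by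
  refine sum_sq_assembly
    (fun i => (Finset.univ.filter fun j : Fin N => dist (X j) (X i) ≤ 2 * R).card)
    (fun i => (((Finset.univ.filter fun j : Fin N => dist (X j) (X i) ≤ 2 * R) ×ˢ
      (Finset.univ.filter fun j : Fin N => dist (X j) (X i) ≤ 2 * R)).filter
        fun p : Fin N × Fin N => p.1 < p.2 ∧ dist (X p.1) (X p.2) < r₀).card)
    _ _ _ _ (card_cells_le hr₀ hR)
    (fun i => card_sq_le_of_dist_le X hr₀ (X i)
      (Finset.univ.filter fun j : Fin N => dist (X j) (X i) ≤ 2 * R)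
      fun _ hj => (Finset.mem_filter.1 hj).2) ?_
  exact sum_card_pairs_le (fun i => Finset.univ.filter fun j : Fin N => dist (X j) (X i) ≤ 2 * R)
    (fun i j hj => by
      simp only [Finset.mem_filter, Finset.mem_univ, true_and] at hj ⊢
      rwa [dist_comm])
    _

end Conjuncts

end PairCounting

/-- **`stub_pairCounting`** (cell counting of close pairs).  For `N` points `X` of `ℝ³` and
`0 < r₀ ≤ 2R`, with `A` the number of close pairs (`j < k`, `dist < r₀`), `n i` the number of
points within `2R` of `X i`, `M = (8R/r₀ + 2)³`, `n⋆ = max n i` and `S = ∑ n i`: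
`(n i)² ≤ 2MA + M (n i)` for every `i`, and `S² ≤ N (2MA n⋆ + MS)`. [folklore] -/
theorem stub_pairCounting :
    ∀ (N : ℕ) (X : Fin N → EuclideanSpace ℝ (Fin 3)) (r₀ R : ℝ), 0 < r₀ → r₀ ≤ 2 * R →
      (∀ i : Fin N,
        (((Finset.univ.filter fun j : Fin N => dist (X j) (X i) ≤ 2 * R).card : ℝ)) ^ 2 ≤
          2 * (8 * R / r₀ + 2) ^ 3 *
              ((Finset.univ.filter fun p : Fin N × Fin N =>
                p.1 < p.2 ∧ dist (X p.1) (X p.2) < r₀).card : ℝ) +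
            (8 * R / r₀ + 2) ^ 3 *
              ((Finset.univ.filter fun j : Fin N => dist (X j) (X i) ≤ 2 * R).card : ℝ)) ∧
      (∑ i : Fin N, ((Finset.univ.filter fun j : Fin N => dist (X j) (X i) ≤ 2 * R).card : ℝ)) ^ 2 ≤
        (N : ℝ) * (2 * (8 * R / r₀ + 2) ^ 3 *
            ((Finset.univ.filter fun p : Fin N × Fin N =>
              p.1 < p.2 ∧ dist (X p.1) (X p.2) < r₀).card : ℝ) *
            ((Finset.univ.sup fun i : Fin N =>
              (Finset.univ.filter fun j : Fin N => dist (X j) (X i) ≤ 2 * R).card : ℕ) : ℝ) +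
          (8 * R / r₀ + 2) ^ 3 *
            ∑ i : Fin N, ((Finset.univ.filter fun j : Fin N => dist (X j) (X i) ≤ 2 * R).card : ℝ))
    :=
  fun _ X _ _ hr₀ hR =>
    ⟨fun i => PairCounting.card_ball_sq_le X hr₀ hR i, PairCounting.sum_card_ball_sq_le X hr₀ hR⟩

end Summit.AtomisticToContinuum.BoseEinsteinCondensation.Theorems.RigidMomentumBound

end
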